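import Literature.NumberTheory.Multiplicative.Balazard1990.Basic
import Literature.NumberTheory.Multiplicative.Balazard1990.KernelFin
import HarnessLib

/-!
# Balazard (1990), Question 2 for `σ`: the finite range `x < 2^12` and the witness `x = 16`

Source: M. Balazard, *Quelques exemples de suites unimodales en théorie des nombres*, Séminaire de Théorie des
Nombres de Bordeaux (2) **2** (1990) 13–30, doi:10.5802/jtnb.17 (open access) [Balazard1990], p. 27 Question 2
(with p. 14: log-concavity, p. 20: `σ(x,k)`).  PRIMARY READ from the vendored page-image excerpt of the H21 archive
(`archive/2001-boxes/tp/literature/sources/balazard-1990-jtnb2-unimodales/EXCERPTS-prove-tp-omega-count-log-concavity.md`,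
§BZ9 = p. 27, §BZ5 = p. 14, §BZ6 = p. 20).

* The row `(σ(x,0), …, σ(x,12))` by recursion on `x` (`rowG`, `rowG_eq`), the kernel pass `finCheck_4095` (the four
  chunks of `Literature.NumberTheory.Multiplicative.Balazard1990.KernelFin` glued by `finRun_add`): for `1 ≤ x < 2^12`, log-concavity of `k ↦ σ(x,k)` (both
  indexings) `↔ x ∈ E` (`isLogConcave_sigma_iff_mem_E_of_lt`, `isLogConcave_sigma_shift_iff_mem_E_of_lt`).
* The witness `x = 16`: `sigma_16 : σ(16,0..4) = 1, 6, 6, 2, 1`, `violation_16 : σ(16,3)² < σ(16,2)·σ(16,4)`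
  (`4 < 6`), hence `question2Sigma_false : ¬ Question2Sigma` — reading (a) "for every `x ≥ 1`" fails at `x = 16` —
  and `question2Sigma₁_false` for the sequence indexed from `k = 1`.

Modules: `Literature.NumberTheory.Multiplicative.Balazard1990.Compute` (kernel-computable data: trial-division `Ω`, the row pass, the breakpoint table),
`KernelFin` / `KernelTab` (the `decide +kernel` evaluations), `Basic` (§§1–3: `sigma`, `IsLogConcave`, `E`, the four
readings `Question2Sigma…`, `omegaC = Ω`, elementary facts), `FiniteRange` (§§4–5: `x < 2^12`, the witness `x = 16`,
`question2Sigma_false`), `TopRange` (§§6–7: `σ(x,K−i)` as a step function, the 84 breakpoints), `Blocks` (§§8–9: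
the nine blocks, `isLogConcave_sigma_iff_mem_E`, `question2SigmaEventually_false`).

Provenance: refutations bundle `papers/_cross/refutations` (H21 seat pub-refute-2, 2026-08-18), package module
`Refutations.Balazard1990 (§§4–5)`, moved into the tree under the Lean-in-tree rule (human 2026-08-18).  The
classification `E` and the proof structure are the 2001 H21 programme's (archive route `tp/omega-count-log-concavity`,
Theorem 1, "review: upheld"); the bundle's exact Python certificate `numerics/balazard1990/check_balazard_sigma_Q2.py`
checks the same two legs independently.
-/

open scoped ArithmeticFunction.Omega

namespace Literature.NumberTheory.Multiplicative.Balazard1990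

/-! ## 4. The row `(σ(x,0), …, σ(x,12))` by recursion on `x`, and the finite range `x < 2^12` -/

/-! `bump l j` (increment entry `j`) and `lcTriples` (the inequalities `u_k u_{k+2} ≤ u_{k+1}²` along a list) are
defined in module `Compute`. -/

/-- The row `[σ(x,0), …, σ(x,12)]` computed incrementally with a given `Ω`-oracle `om`. [folklore] -/
def rowG (om : ℕ → ℕ) : ℕ → List ℕ
  | 0 => List.replicate 13 0
  | x + 1 => bump (rowG om x) (om (x + 1))

/-- Auxiliary lemma: `(f : ℕ → ℕ) : ∀ (n s j : ℕ), bump ((List.range' s n).map f) j = (List.range' s n).map (fun k => f k + if j + s = k then 1 else 0)`. [folklore] -/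
theorem bump_map_range' (f : ℕ → ℕ) : ∀ (n s j : ℕ),
    bump ((List.range' s n).map f) j = (List.range' s n).map (fun k => f k + if j + s = k then 1 else 0) := by
  intro n
  induction n with
  | zero => intro s j; simp [bump]
  | succ n ih =>
    intro s j
    rw [List.range'_succ, List.map_cons, List.map_cons]
    cases j with
    | zero =>
      simp only [bump, zero_add, if_true]
      congr 1
      apply List.map_congr_left
      intro k hk
      rw [List.mem_range'] at hk
      obtain ⟨i, hi, rfl⟩ := hk
      have : ¬ (s = s + 1 + i) := by omega
      simp [this]
    | succ j =>
      simp only [bump]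
      rw [ih (s + 1) j]
      have : ¬ (j + 1 + s = s) := by omega
      simp only [this, if_false, add_zero]
      congr 1
      apply List.map_congr_left
      intro k hk
      congr 2
      apply propext; constructor <;> intro h <;> omega

/-- Auxiliary lemma: `(x : ℕ) : rowG (fun n => Ω n) x = (List.range 13).map (sigma x)`. [folklore] -/
theorem rowG_eq (x : ℕ) : rowG (fun n => Ω n) x = (List.range 13).map (sigma x) := by
  induction x with
  | zero =>
    simp only [rowG]
    rw [show (List.range 13).map (sigma 0) = (List.range 13).map (fun _ => 0) from
      List.map_congr_left (fun k _ => sigma_zero k)]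
    simp
  | succ x ih =>
    simp only [rowG]
    rw [ih, List.range_eq_range', bump_map_range']
    apply List.map_congr_left
    intro k _
    rw [sigma_succ, add_zero]

/-- Auxiliary lemma: `{x : ℕ} (hx : x < 4096) : lcTriples ((List.range 13).map (sigma x)) = true ↔ ∀ k : ℕ, sigma x k * sigma x (k + 2) ≤ sigma x (k + 1) ^ 2`. [folklore] -/
theorem lcTriples_row_iff {x : ℕ} (hx : x < 4096) :
    lcTriples ((List.range 13).map (sigma x)) = true ↔
      ∀ k : ℕ, sigma x k * sigma x (k + 2) ≤ sigma x (k + 1) ^ 2 := by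
  have hz : ∀ k, 12 ≤ k → sigma x k = 0 := fun k hk =>
    sigma_eq_zero_of_lt (lt_of_lt_of_le hx (by
      calc (4096 : ℕ) = 2 ^ 12 := by norm_num
        _ ≤ 2 ^ k := Nat.pow_le_pow_right (by norm_num) hk))
  simp only [List.range, List.range.loop, List.map_cons, List.map_nil, lcTriples, Bool.and_eq_true,
    decide_eq_true_eq, Bool.and_true, sq]
  constructor
  · rintro ⟨h0, h1, h2, h3, h4, h5, h6, h7, h8, h9, h10⟩ k
    rcases Nat.lt_or_ge k 11 with hk | hk
    · interval_cases k <;> assumption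
    · rw [hz (k + 2) (by omega)]; simp
  · intro h
    exact ⟨h 0, h 1, h 2, h 3, h 4, h 5, h 6, h 7, h 8, h 9, h 10⟩

/-- Auxiliary lemma: `{x : ℕ} (hx : x < 4096) : lcTriples ((List.range 13).map (sigma x)).tail = true ↔ ∀ k : ℕ, sigma x (k + 1) * sigma x (k + 3) ≤ sigma x (k + 2) ^ 2`. [folklore] -/
theorem lcTriples_row_tail_iff {x : ℕ} (hx : x < 4096) :
    lcTriples ((List.range 13).map (sigma x)).tail = true ↔
      ∀ k : ℕ, sigma x (k + 1) * sigma x (k + 3) ≤ sigma x (k + 2) ^ 2 := by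
  have hz : ∀ k, 12 ≤ k → sigma x k = 0 := fun k hk =>
    sigma_eq_zero_of_lt (lt_of_lt_of_le hx (by
      calc (4096 : ℕ) = 2 ^ 12 := by norm_num
        _ ≤ 2 ^ k := Nat.pow_le_pow_right (by norm_num) hk))
  simp only [List.range, List.range.loop, List.map_cons, List.map_nil, List.tail_cons, lcTriples,
    Bool.and_eq_true, decide_eq_true_eq, Bool.and_true, sq]
  constructor
  · rintro ⟨h1, h2, h3, h4, h5, h6, h7, h8, h9, h10⟩ k
    rcases Nat.lt_or_ge k 10 with hk | hk
    · interval_cases k <;> assumption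
    · rw [hz (k + 3) (by omega)]; simp
  · intro h
    exact ⟨h 0, h 1, h 2, h 3, h 4, h 5, h 6, h 7, h 8, h 9⟩

/-! The pass `finRun x₀ st n` / `finStep` / `finInit` (from `Compute.lean`) runs `x = x₀+1, …, x₀+n`: the first
component is the row of `x`, the flag accumulates "`lcTriples row = inEb x` and `lcTriples row.tail = inEb x`". -/

/-- Auxiliary lemma: `(x : ℕ) : (finRun 0 finInit x).1 = rowG omegaC x`. [folklore] -/
theorem finCheck_fst (x : ℕ) : (finRun 0 finInit x).1 = rowG omegaC x := by
  induction x with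
  | zero => rfl
  | succ x ih => simp only [finRun, finStep, rowG, ih, Nat.zero_add]

/-- Auxiliary lemma: `(b : Bool) (x : ℕ) : (b == inEb x) = true ↔ (b = true ↔ InE x)`. [folklore] -/
theorem beq_inEb_iff (b : Bool) (x : ℕ) : (b == inEb x) = true ↔ (b = true ↔ InE x) := by
  rw [← inEb_iff]; cases b <;> cases inEb x <;> simp

/-- Auxiliary lemma: `(N : ℕ) (h : (finRun 0 finInit N).2 = true) : ∀ x : ℕ, 1 ≤ x → x ≤ N → (lcTriples (rowG omegaC x) = true ↔ InE x) ∧ (lcTriples (rowG omegaC x).tail = true ↔ InE x)`. [folklore] -/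
theorem finCheck_snd (N : ℕ) (h : (finRun 0 finInit N).2 = true) :
    ∀ x : ℕ, 1 ≤ x → x ≤ N →
      (lcTriples (rowG omegaC x) = true ↔ InE x) ∧ (lcTriples (rowG omegaC x).tail = true ↔ InE x) := by
  induction N with
  | zero => intro x h1 h2; omega
  | succ N ih =>
    intro x h1 h2
    have hstep : (finRun 0 finInit (N + 1)).2 = ((finRun 0 finInit N).2 && (lcTriples (rowG omegaC (N + 1)) == inEb (N + 1))
        && (lcTriples (rowG omegaC (N + 1)).tail == inEb (N + 1))) := by
      simp only [finRun, finStep, finCheck_fst, rowG, Nat.zero_add]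
    rw [hstep, Bool.and_eq_true, Bool.and_eq_true, beq_inEb_iff, beq_inEb_iff] at h
    rcases Nat.lt_or_ge x (N + 1) with hx | hx
    · exact ih h.1.1 x h1 (by omega)
    · have hx' : x = N + 1 := by omega
      subst hx'
      exact ⟨h.1.2, h.2⟩

/-- The certified finite computation: for `1 ≤ x ≤ 4095` both readings of log-concavity of the row of `x`
agree with `x ∈ E` — assembled from the four kernel-evaluated chunks `finRun_chunk1..4`
(`Refutations/Balazard1990/KernelFin1..4.lean`, `decide +kernel`; 4095 trial-division factorisations in all). [folklore] -/
theorem finCheck_4095 : (finRun 0 finInit 4095).2 = true := by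
  rw [show (4095 : ℕ) = ((1024 + 1024) + 1024) + 1023 from rfl, finRun_add, finRun_add, finRun_add]
  simp only [Nat.zero_add, Nat.reduceAdd]
  rw [finRun_chunk1, finRun_chunk2, finRun_chunk3]
  exact finRun_chunk4

/-- **Finite range.** For `1 ≤ x < 2^12`: `k ↦ σ(x,k)` is log-concave iff `x ∈ E`. [folklore] -/
theorem isLogConcave_sigma_iff_mem_E_of_lt {x : ℕ} (h1 : 1 ≤ x) (hx : x < 4096) :
    IsLogConcave (sigma x) ↔ x ∈ E := by
  have h := (finCheck_snd 4095 finCheck_4095 x h1 (by omega)).1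
  rw [omegaC_eq_fun, rowG_eq, lcTriples_row_iff hx] at h
  rw [isLogConcave_sigma_iff, mem_E]
  exact h

/-- Finite range, sequence indexed from `k = 1`. [folklore] -/
theorem isLogConcave_sigma_shift_iff_mem_E_of_lt {x : ℕ} (h1 : 1 ≤ x) (hx : x < 4096) :
    IsLogConcave (fun k => sigma x (k + 1)) ↔ x ∈ E := by
  have h := (finCheck_snd 4095 finCheck_4095 x h1 (by omega)).2
  rw [omegaC_eq_fun, rowG_eq, lcTriples_row_tail_iff hx] at h
  rw [isLogConcave_sigma_shift_iff, mem_E]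
  exact h

/-! ## 5. The witness `x = 16` -/

/-- Auxiliary lemma: `: (List.range 13).map (sigma 16) = [1, 6, 6, 2, 1, 0, 0, 0, 0, 0, 0, 0, 0]`. [folklore] -/
theorem row_16 : (List.range 13).map (sigma 16) = [1, 6, 6, 2, 1, 0, 0, 0, 0, 0, 0, 0, 0] := by
  rw [← rowG_eq, ← omegaC_eq_fun]
  decide +kernel

/-- Auxiliary lemma: `: sigma 16 0 = 1 ∧ sigma 16 1 = 6 ∧ sigma 16 2 = 6 ∧ sigma 16 3 = 2 ∧ sigma 16 4 = 1`. [folklore] -/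
theorem sigma_16 : sigma 16 0 = 1 ∧ sigma 16 1 = 6 ∧ sigma 16 2 = 6 ∧ sigma 16 3 = 2 ∧ sigma 16 4 = 1 := by
  have h := row_16
  simp only [List.range, List.range.loop, List.map_cons, List.map_nil, List.cons.injEq] at h
  exact ⟨h.1, h.2.1, h.2.2.1, h.2.2.2.1, h.2.2.2.2.1⟩

/-- `σ(16,3)² = 4 < 6 = σ(16,2)·σ(16,4)`: a violation at `k = 3`. [folklore] -/
theorem violation_16 : sigma 16 3 ^ 2 < sigma 16 2 * sigma 16 4 := by
  obtain ⟨-, -, h2, h3, h4⟩ := sigma_16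
  rw [h2, h3, h4]; norm_num

/-- Auxiliary lemma: `: ¬ IsLogConcave (sigma 16)`. [folklore] -/
theorem not_isLogConcave_sigma_16 : ¬ IsLogConcave (sigma 16) := by
  intro h
  obtain ⟨-, -, e2, e3, e4⟩ := sigma_16
  have h2 : sigma 16 2 * sigma 16 4 ≤ sigma 16 3 ^ 2 := h.1 2
  rw [e2, e3, e4] at h2
  norm_num at h2

/-- Auxiliary lemma: `: ¬ IsLogConcave (fun k => sigma 16 (k + 1))`. [folklore] -/
theorem not_isLogConcave_sigma_shift_16 : ¬ IsLogConcave (fun k => sigma 16 (k + 1)) := by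
  intro h
  obtain ⟨-, -, e2, e3, e4⟩ := sigma_16
  have h2 : sigma 16 2 * sigma 16 4 ≤ sigma 16 3 ^ 2 := h.1 1
  rw [e2, e3, e4] at h2
  norm_num at h2

/-- Answer to Question 2 for `σ`, reading (a) (every `x ≥ 1`): **no** (`x = 16`). [folklore] -/
theorem question2Sigma_false : ¬ Question2Sigma := fun h => not_isLogConcave_sigma_16 (h 16 (by norm_num))

/-- Auxiliary lemma: `: ¬ Question2Sigma₁`. [folklore] -/
theorem question2Sigma₁_false : ¬ Question2Sigma₁ := fun h => not_isLogConcave_sigma_shift_16 (h 16 (by norm_num))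


end Literature.NumberTheory.Multiplicative.Balazard1990
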